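import Summits.RiemannHypothesis.RiemannHypothesis.Theorems.WeilFormatCWindowLimit
import Literature.NumberTheory.LFunctions.YoshidaWindowFourierSeries
import HarnessLib

/-!
# Format C (Fourier–Galerkin certificates of Weil positivity): the dictionary — positivity of the
  window form on the trigonometric windows `Σ_{|n| ≤ N} c_n χ_n` implies `WeilPositivityOn a`

Helper file (`--supports stmt-RiemannHypothesis-0098`, lead-track anchor), RH-free. Seat
rh-explicit-weil-3 (gen3); item L-C4 of the format-C analysis layer (WEIL3-STRUCTURE §7.2,
FORMATC-DESIGN §1 (c4)).

* `tendsto_weilWindowForm_proj`: for `φ ∈ K(a)` (Yoshida's smooth `2a`-periodic functions cut off at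
  the window) the truncated Fourier series `proj a N φ = Σ_{|n| ≤ N} (2a)^{-1/2} c_n(φ) χ_n` (Yoshida
  1992 §3; `Literature/…/YoshidaWindowFourierSeries.lean`: uniform convergence with `N`-uniform sup
  and Lipschitz bounds) is a window family in the sense of `WeilFormatCWindowFamily/Limit.lean`, so
  `weilWindowForm a (proj a N φ) → weilWindowForm a φ`; hence (`weilWindowForm_nonneg_of_mem_K`)
  positivity on the trigonometric windows gives positivity of the window form on ALL of `K(a)`.
* `weilPositivityOn_of_weilWindowForm_sum_chi_nonneg` (**the dictionary**): if
  `weilWindowForm a (Σ_{|n| ≤ N} c_n χ_n) ≥ 0` for all `N` and all `c : ℤ → ℂ`, then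
  `WeilPositivityOn a`. This is the passage "positivity on `W_N = span{χ_n : |n| ≤ N} ⊂ K(a)` for
  all `N` ⟹ positivity on `C(a)`" by which a finite hermitian-matrix certificate on the window
  becomes a rung of `RiemannHypothesis ↔ ∀ a, WeilPositivityOn a`
  (`riemannHypothesis_iff_forall_weilPositivityOn`). Yoshida 1992 states his positivity results on
  `K(a) ⊃ C(a)` (Thm. 1, p. 310); Connes–Consani 2021 §2 compute the form on the same windows.

Not here: the matrix entries of `c ↦ weilWindowForm a (Σ c_n χ_n)` (Yoshida (5.13)–(5.16); item
L-C1) and any certificate format.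
-/

set_option autoImplicit false
set_option linter.dupNamespace false  -- the mandated namespace repeats `RiemannHypothesis`

noncomputable section

open Complex Filter Set MeasureTheory
open scoped Real Topology ComplexConjugate

namespace Summit.RiemannHypothesis.RiemannHypothesis.Theorems.WeilFormatC

open Literature.NumberTheory.LFunctions
open Literature.NumberTheory.LFunctions.Yoshida1992 (modes chi proj trigPoly trigPolyDeriv
  proj_apply_of_mem proj_apply_of_not_mem proj_apply_eq_indicator_trigPoly norm_trigPoly_le
  norm_trigPoly_sub_le norm_trigPolyDeriv_le norm_sub_trigPoly_le tendsto_tsum_compl_modes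
  summable_pow_mul_norm_fourierCoeff)

variable {a : ℝ} {φ : ℝ → ℂ}

/-- The truncated Fourier series of `φ ∈ K(a)` (`a > 0`) is a window family in the sense of
`tendsto_weilWindowForm_of_uniform` (measurable, zero off `[-a,a]`, `N`-uniformly bounded and
`N`-uniformly Lipschitz on the closed window, uniformly convergent to `φ`), hence
`weilWindowForm a (proj a N φ) → weilWindowForm a φ`: the window form is continuous along Fourier
truncation on all of Yoshida's `K(a)`. -/
theorem tendsto_weilWindowForm_proj (ha : 0 < a) (hφ : φ ∈ Yoshida1992.K a) :
    Tendsto (fun N ↦ weilWindowForm a (proj a N φ)) atTop (𝓝 (weilWindowForm a φ)) := by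
  have hsum0 : Summable fun n : ℤ ↦ ‖Yoshida1992.fourierCoeff a n φ‖ := by
    simpa using summable_pow_mul_norm_fourierCoeff ha hφ 0
  have hsum1 := summable_pow_mul_norm_fourierCoeff ha hφ 1
  have hcont : ∀ N, Continuous (trigPoly a N φ) := fun N ↦
    continuous_finsetSum _ fun n _ ↦ continuous_const.mul
      (Complex.continuous_exp.comp ((continuous_const.mul Complex.continuous_ofReal).div_const _))
  refine tendsto_weilWindowForm_of_uniform (u := fun N ↦ proj a N φ)
    (S₀ := ∑' n : ℤ, ‖Yoshida1992.fourierCoeff a n φ‖ / (2 * a))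
    (S₁ := (π / a / (2 * a)) * ∑' n : ℤ, |(n : ℝ)| ^ 1 * ‖Yoshida1992.fourierCoeff a n φ‖)
    (δ := fun N ↦ ∑' n : {n // n ∉ modes N}, ‖Yoshida1992.fourierCoeff a n φ‖ / (2 * a))
    ha (fun N ↦ ?_) (fun N x hx ↦ proj_apply_of_not_mem ha N φ hx) (fun N x ↦ ?_)
    (fun N x y hx hy ↦ ?_) (fun N x ↦ ?_) (tendsto_tsum_compl_modes a φ)
  · -- measurability: indicator of the window times a continuous function
    have : proj a N φ = (Icc (-a) a).indicator (trigPoly a N φ) :=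
      funext fun x ↦ proj_apply_eq_indicator_trigPoly ha N φ x
    rw [this]
    exact (hcont N).measurable.indicator measurableSet_Icc
  · by_cases hx : x ∈ Icc (-a) a
    · rw [proj_apply_of_mem ha N φ hx]
      exact norm_trigPoly_le ha hsum0 N x
    · rw [proj_apply_of_not_mem ha N φ hx, norm_zero]
      exact tsum_nonneg fun n ↦ by positivity
  · rw [proj_apply_of_mem ha N φ hx, proj_apply_of_mem ha N φ hy]
    exact norm_trigPoly_sub_le (fun z ↦ norm_trigPolyDeriv_le ha hsum1 N z) x y
  · by_cases hx : x ∈ Icc (-a) a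
    · rw [proj_apply_of_mem ha N φ hx, norm_sub_rev]
      exact norm_sub_trigPoly_le ha hφ N hx
    · rw [proj_apply_of_not_mem ha N φ hx,
        Yoshida1992.eq_zero_of_mem_K hφ (lt_abs_of_not_mem_Icc_window hx), sub_zero, norm_zero]
      exact tsum_nonneg fun n ↦ by positivity

/-- **Positivity on the trigonometric windows implies positivity of the window form on all of
`K(a)`.** If `weilWindowForm a (Σ_{|n| ≤ N} c_n χ_n) ≥ 0` for all `N` and all coefficients
`c : ℤ → ℂ`, then `weilWindowForm a φ ≥ 0` for every `φ ∈ K(a)` (Yoshida's space of smooth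
`2a`-periodic functions cut off at the window; `a > 0`). -/
theorem weilWindowForm_nonneg_of_mem_K (ha : 0 < a)
    (h : ∀ (N : ℕ) (c : ℤ → ℂ), 0 ≤ weilWindowForm a (∑ n ∈ modes N, c n • chi a n))
    (hφ : φ ∈ Yoshida1992.K a) : 0 ≤ weilWindowForm a φ :=
  ge_of_tendsto' (tendsto_weilWindowForm_proj ha hφ) fun N ↦
    h N fun n ↦ (((1 / Real.sqrt (2 * a) : ℝ) : ℂ) * Yoshida1992.fourierCoeff a n φ)

/-- **The dictionary (format C ⟹ a rung).** Let `a > 0`. If the window form is non-negative on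
every trigonometric window, i.e. `weilWindowForm a (Σ_{|n| ≤ N} c_n χ_n) ≥ 0` for all `N` and all
coefficients `c : ℤ → ℂ` (`χ_n = chi a n = (2a)^{-1/2} e^{iπnx/a} 𝟙_{[-a,a]}`, Yoshida's basis of
`K(a)`), then Weil positivity holds for every test function supported in `[-a, a]`:
`WeilPositivityOn a`. Proof: a test function `g` supported in `[-a, a]` lies in `C(a) ⊂ K(a)`
(`Yoshida1992.C_le_K`), and `Re Q(g) = weilWindowForm a g ≥ 0` by
`weilWindowForm_nonneg_of_mem_K`. (Yoshida 1992 states his positivity results on `K(a) ⊃ C(a)`,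
Thm. 1 p. 310; this is the passage from the finite sections `W_N = span{χ_n : |n| ≤ N}` to `C(a)`;
with `riemannHypothesis_iff_forall_weilPositivityOn` every such certificate is one case of RH.) -/
theorem weilPositivityOn_of_weilWindowForm_sum_chi_nonneg (ha : 0 < a)
    (h : ∀ (N : ℕ) (c : ℤ → ℂ), 0 ≤ weilWindowForm a (∑ n ∈ modes N, c n • chi a n)) :
    WeilPositivityOn a := by
  intro g hg hsupp
  rw [← weilWindowForm_eq_re_weilQuadratic hg hsupp]
  exact weilWindowForm_nonneg_of_mem_K ha h (Yoshida1992.C_le_K ha ⟨hg, hsupp⟩)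

end Summit.RiemannHypothesis.RiemannHypothesis.Theorems.WeilFormatC

end
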